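import Summits.SmoothPoincare4.SmoothPoincare4.Theses.EntropyRung
import Summits.SmoothPoincare4.SmoothPoincare4.Theorems.EntropyRungSubcylindricalExistenceGluingCutoffBound
import Summits.SmoothPoincare4.SmoothPoincare4.Theorems.EntropyRungSubcylindricalExistenceCapFactorRound
import Summits.SmoothPoincare4.SmoothPoincare4.Theorems.EntropyRungSubcylindricalExistenceCapFactorSchwarzschild
import Summits.SmoothPoincare4.SmoothPoincare4.Theorems.EntropyRungSubcylindricalExistenceGradSqFlatChart
import Summits.SmoothPoincare4.SmoothPoincare4.Theorems.EntropyRungSubcylindricalExistenceSetIntegralFlatChart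
import Mathlib.MeasureTheory.Constructions.HaarToSphere
import Mathlib.MeasureTheory.Measure.Lebesgue.VolumeOfBalls
import Mathlib.Analysis.SpecialFunctions.Integrals.Basic
import HarnessLib

/-!
# The `L²`-norm of the logarithmic cut-off gradients in the flat gauge with mass
# (line `green-blowup-conformal-entropy`, crux `EntropyRung.SubcylindricalExistence`,
# stmt-SmoothPoincare4-10871; stub Cut' `stub_cutoffSqIntegralSchwarzschild` of lead c3's reshape R-c3)

This is c2's `gluingCutoffSqIntegral` (`EntropyRungSubcylindricalExistenceGluingCutoffBound.lean`) in
the Schwarzschild gauge: Green data at `p` with `φ = extChartAt p` a `g`-isometry on the closed ball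
`B̄(y₀, r)` (`y₀ = φ p`) and `G ∘ φ⁻¹ = a/‖y − y₀‖² + b` there, `a > 0`, `b ≥ 0` constant (the mass
term). For a cut-off pair `χ₁² + χ₂² = 1` with `χ₁ = 1` on `{G ≤ S}`, `χ₁ = 0` on `{G ≥ S²} ∪ {p}`
and `|∇χ₁|² + |∇χ₂|² ≤ (C/log²S) G⁻²|∇G|²`, and the annulus `{S ≤ G ≤ S²}` captured by the open chart
ball, under `2 ≤ S`, `2b ≤ S`:

  `∫ (|∇χ₁|²_g + |∇χ₂|²_g)² dV_g ≤ (C/log²S)² · 32π² log S`.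

Proof (as in c2's file, whose Euclidean and vanishing lemmas are imported): the integrand vanishes off
the annulus; in the chart the annulus lies in `{√a/S ≤ ‖y − y₀‖ ≤ √(2a/S)}` (`a/ρ² = G − b` with
`S − b ≥ S/2`); on it `|∇G|²_g = 4a²/ρ⁶` (S0 `stub_gradSqFlatChart` and the Euclidean gradient of the
model, the constant `b` being invisible: `CapFactorSchwarzschild.gradient_green_comp_symm`) and
`G = (a + bρ²)/ρ² ≥ a/ρ²`, so `G⁻²|∇G|²_g ≤ 4/ρ²`; `dV_g = dy` on the ball (S0b
`stub_setIntegralFlatChart`); and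
`∫_{√a/S ≤ ‖z‖ ≤ √(2a/S)} ‖z‖⁻⁴ dz = 2π² log √(2S) ≤ 2π² log S` for `S ≥ 2`
(`GluingCutoffBound.integral_annulus_inv_pow_four`). Everything is proved; no definitions, no named facts.
References: Lee–Parker 1987, §6 (the Green-function blow-up and its logarithmic cut-offs); Schoen 1984.
-/

noncomputable section

set_option linter.dupNamespace false

open scoped Manifold ContDiff Topology RealInnerProductSpace
open Set Filter MeasureTheory Metric
open Literature.Geometry.Lorentzian

namespace Summit.SmoothPoincare4.SmoothPoincare4.Theorems

namespace GluingCutoffBoundSchwarzschild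

/-! ### Two elementary inequalities -/

/-- `G⁻² |∇G|² ≤ 4/ρ²` for `G = a/ρ² + b`, `|∇G|² = 4a²/ρ⁶`, `a > 0`, `b ≥ 0`, `ρ² = d > 0`. [folklore] -/
theorem inv_sq_mul_gradSq_model_le {a b d : ℝ} (ha : 0 < a) (hb : 0 ≤ b) (hd : 0 < d) :
    (a / d + b)⁻¹ ^ 2 * (4 * a ^ 2 / d ^ 3) ≤ 4 * d⁻¹ := by
  have ht : (a / d + b)⁻¹ ≤ d / a :=
    (inv_anti₀ (by positivity : 0 < a / d) (le_add_of_nonneg_right hb)).trans_eq (inv_div _ _)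
  have ht0 : 0 ≤ (a / d + b)⁻¹ := by positivity
  calc (a / d + b)⁻¹ ^ 2 * (4 * a ^ 2 / d ^ 3) ≤ (d / a) ^ 2 * (4 * a ^ 2 / d ^ 3) := by gcongr
    _ = 4 * d⁻¹ := by field_simp

/-- For `2 ≤ S` and `a > 0`: `√(2a/S) ≤ S · (√a/S)`, i.e. the ratio of the annulus radii
`√(2a/S) / (√a/S) = √(2S)` is at most `S`. [folklore] -/
theorem sqrt_ratio_le {a S : ℝ} (ha : 0 < a) (hS : 2 ≤ S) :
    Real.sqrt (2 * a / S) / (Real.sqrt a / S) ≤ S := by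
  have hS0 : 0 < S := by linarith
  have hρ₁pos : 0 < Real.sqrt a / S := by positivity
  rw [div_le_iff₀ hρ₁pos]
  have hSρ₁ : S * (Real.sqrt a / S) = Real.sqrt a := by field_simp
  rw [hSρ₁]
  apply Real.sqrt_le_sqrt
  rw [div_le_iff₀ hS0]
  nlinarith

/-! ### The bound -/

section Manifold

variable {M : Type} [TopologicalSpace M] [T2Space M] [SecondCountableTopology M]
  [ChartedSpace (EuclideanSpace ℝ (Fin 4)) M] [IsManifold (𝓡 4) ∞ M] [CompactSpace M]
  [T3Space M] [MeasurableSpace M] [BorelSpace M]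
  (g : PseudoRiemannianMetric (𝓡 4) ∞ (EuclideanSpace ℝ (Fin 4)) (TangentSpace (𝓡 4) : M → Type _))

/-- **The `L²`-norm of the cut-off gradients in the flat gauge with mass.** See the module docstring:
`∫ (|∇χ₁|²_g + |∇χ₂|²_g)² dV_g ≤ (C/log²S)² · 32π² log S` (named hypotheses; the registered ∀-form is
`stub_cutoffSqIntegralSchwarzschild` below). The side condition `a/r² + b < S` of the registered form
is not needed: the capture hypothesis `hcapt` already places the annulus in the chart ball. [folklore] -/
theorem cutoff_sq_integral_le [g.HasLeviCivita] (hg : g.IsRiemannian) {p : M} {G : M → ℝ}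
    (hGs : ContMDiffOn (𝓡 4) 𝓘(ℝ, ℝ) ∞ G {p}ᶜ) {a b r : ℝ} (ha : 0 < a) (hb : 0 ≤ b) (hr : 0 < r)
    (hsub : Metric.closedBall (extChartAt (𝓡 4) p p) r ⊆ (extChartAt (𝓡 4) p).target)
    (hflat : ∀ y ∈ Metric.closedBall (extChartAt (𝓡 4) p p) r, ∀ X W : EuclideanSpace ℝ (Fin 4),
      g.val ((extChartAt (𝓡 4) p).symm y)
        (mfderiv 𝓘(ℝ, EuclideanSpace ℝ (Fin 4)) (𝓡 4) (extChartAt (𝓡 4) p).symm y X)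
        (mfderiv 𝓘(ℝ, EuclideanSpace ℝ (Fin 4)) (𝓡 4) (extChartAt (𝓡 4) p).symm y W) = ⟪X, W⟫)
    (hGeq : ∀ y ∈ Metric.closedBall (extChartAt (𝓡 4) p p) r, y ≠ extChartAt (𝓡 4) p p →
      G ((extChartAt (𝓡 4) p).symm y) = a / ‖y - extChartAt (𝓡 4) p p‖ ^ 2 + b)
    {C S : ℝ} (hC : 0 ≤ C) (hS : 2 ≤ S) (hbS : 2 * b ≤ S)
    {χ₁ χ₂ : M → ℝ} (hχ₁ : ContMDiff (𝓡 4) 𝓘(ℝ, ℝ) ∞ χ₁) (hχ₂ : ContMDiff (𝓡 4) 𝓘(ℝ, ℝ) ∞ χ₂)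
    (h1 : ∀ y, χ₁ y ^ 2 + χ₂ y ^ 2 = 1) (hone : ∀ x, x ≠ p → G x ≤ S → χ₁ x = 1)
    (hzero : ∀ x, x ≠ p → S ^ 2 ≤ G x → χ₁ x = 0) (hχ₁p : χ₁ p = 0)
    (hbound : ∀ x, x ≠ p →
      g.gradSq χ₁ x + g.gradSq χ₂ x ≤ C / Real.log S ^ 2 * ((G x)⁻¹ ^ 2 * g.gradSq G x))
    (hGlim : Tendsto G (𝓝[≠] p) atTop)
    (hcapt : ∀ x, x ≠ p → S ≤ G x →
      x ∈ (extChartAt (𝓡 4) p).source ∧ extChartAt (𝓡 4) p x ∈ Metric.ball (extChartAt (𝓡 4) p p) r) :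
    ∫ x, (g.gradSq χ₁ x + g.gradSq χ₂ x) ^ 2 ∂(riemannianMeasure (g.toContMDiffRiemannianMetric hg)) ≤
      (C / Real.log S ^ 2) ^ 2 * (32 * Real.pi ^ 2 * Real.log S) := by
  set μ : Measure M := riemannianMeasure (g.toContMDiffRiemannianMetric hg) with hμ
  set Q : M → ℝ := fun x ↦ g.gradSq χ₁ x + g.gradSq χ₂ x with hQ
  have hS0 : 0 < S := by linarith
  have hGc : ContinuousOn G {p}ᶜ := hGs.continuousOn
  -- (1) vanishing where `G < S`
  have hvan1 : ∀ x, x ≠ p → G x < S → Q x = 0 := by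
    intro x hx hGx
    have hev : χ₁ =ᶠ[𝓝 x] fun _ ↦ (1 : ℝ) := by
      have hopen : IsOpen ({p}ᶜ ∩ G ⁻¹' Iio S) :=
        hGc.isOpen_inter_preimage isOpen_compl_singleton isOpen_Iio
      filter_upwards [hopen.mem_nhds ⟨hx, hGx⟩] with y hy
      exact hone y hy.1 (le_of_lt hy.2)
    exact GluingCutoffBound.gradSq_pair_eq_zero g hχ₂ h1 hev
  -- (2) vanishing where `G > S²` and at `p`
  have hvan2 : ∀ x, x ≠ p → S ^ 2 < G x → Q x = 0 := by
    intro x hx hGx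
    have hev : χ₁ =ᶠ[𝓝 x] fun _ ↦ (0 : ℝ) := by
      have hopen : IsOpen ({p}ᶜ ∩ G ⁻¹' Ioi (S ^ 2)) :=
        hGc.isOpen_inter_preimage isOpen_compl_singleton isOpen_Ioi
      filter_upwards [hopen.mem_nhds ⟨hx, hGx⟩] with y hy
      exact hzero y hy.1 (le_of_lt hy.2)
    exact GluingCutoffBound.gradSq_pair_eq_zero g hχ₂ h1 hev
  have hvanp : Q p = 0 := by
    have hev : χ₁ =ᶠ[𝓝 p] fun _ ↦ (0 : ℝ) := by
      have hlarge : ∀ᶠ y in 𝓝[≠] p, S ^ 2 ≤ G y := hGlim.eventually (eventually_ge_atTop _)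
      rw [eventually_nhdsWithin_iff] at hlarge
      filter_upwards [hlarge] with y hy
      rcases eq_or_ne y p with hyp | hyp
      · rw [hyp, hχ₁p]
      · exact hzero y hyp (hy hyp)
    exact GluingCutoffBound.gradSq_pair_eq_zero g hχ₂ h1 hev
  -- nonnegativity
  have hQ0 : ∀ x, 0 ≤ Q x := fun x ↦ add_nonneg (g.gradSq_nonneg hg χ₁ x) (g.gradSq_nonneg hg χ₂ x)
  -- (3) `Q` vanishes off the closed chart ball
  set Bset : Set M := {x | x ∈ (extChartAt (𝓡 4) p).source ∧
    extChartAt (𝓡 4) p x ∈ Metric.closedBall (extChartAt (𝓡 4) p p) r} with hBset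
  have hQoff : ∀ x, x ∉ Bset → (Q x) ^ 2 = 0 := by
    intro x hx
    have hxp : x ≠ p := by
      intro hxp'
      apply hx
      rw [hxp']
      exact ⟨mem_extChartAt_source p, Metric.mem_closedBall_self hr.le⟩
    have hGx : G x < S := by
      by_contra hcon
      obtain ⟨hs, hb'⟩ := hcapt x hxp (le_of_not_gt hcon)
      exact hx ⟨hs, Metric.ball_subset_closedBall hb'⟩
    rw [hvan1 x hxp hGx]
    ring
  have hQc : Continuous Q :=
    (Literature.Geometry.Riemannian.contMDiff_gradSq g hχ₁).continuous.add
      (Literature.Geometry.Riemannian.contMDiff_gradSq g hχ₂).continuous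
  have hstep3 : ∫ x, (Q x) ^ 2 ∂μ = ∫ x in Bset, (Q x) ^ 2 ∂μ :=
    (setIntegral_eq_integral_of_forall_compl_eq_zero fun x hx ↦ hQoff x hx).symm
  -- (4) read the integral in the chart (S0b)
  have hstep4 : ∫ x in Bset, (Q x) ^ 2 ∂μ =
      ∫ y in Metric.closedBall (extChartAt (𝓡 4) p p) r, (Q ((extChartAt (𝓡 4) p).symm y)) ^ 2 :=
    stub_setIntegralFlatChart M g hg p r hr hsub hflat (fun x ↦ (Q x) ^ 2) (hQc.pow 2)
  -- (5) pointwise bound in the chart: the annulus lies in `{ρ₁ ≤ ‖y - y₀‖ ≤ ρ₂}`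
  set ρ₁ : ℝ := Real.sqrt a / S with hρ₁
  set ρ₂ : ℝ := Real.sqrt (2 * a / S) with hρ₂
  have hρ₁pos : 0 < ρ₁ := by positivity
  have hρ₁sq : ρ₁ ^ 2 = a / S ^ 2 := by rw [hρ₁, div_pow, Real.sq_sqrt ha.le]
  have hρ₂sq : ρ₂ ^ 2 = 2 * a / S := by rw [hρ₂, Real.sq_sqrt (by positivity)]
  have hρ₁₂ : ρ₁ ≤ ρ₂ := by
    have h1' : ρ₁ ^ 2 ≤ ρ₂ ^ 2 := by
      rw [hρ₁sq, hρ₂sq, div_le_div_iff₀ (by positivity) hS0]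
      nlinarith [mul_pos ha hS0]
    nlinarith [hρ₁pos, Real.sqrt_nonneg (2 * a / S)]
  set κ : ℝ := C / Real.log S ^ 2 * 4 with hκ
  have hκ0 : 0 ≤ κ := by positivity
  set F : EuclideanSpace ℝ (Fin 4) → ℝ := fun y ↦
    κ ^ 2 * (Icc ρ₁ ρ₂).indicator (fun t : ℝ ↦ (t ^ 4)⁻¹) ‖y - (extChartAt (𝓡 4) p p)‖ with hF
  have hF0 : ∀ y, 0 ≤ F y := fun y ↦ by
    simp only [hF]
    refine mul_nonneg (sq_nonneg _) (indicator_nonneg (fun t _ ↦ by positivity) _)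
  have hpt : ∀ y ∈ Metric.closedBall (extChartAt (𝓡 4) p p) r,
      (Q ((extChartAt (𝓡 4) p).symm y)) ^ 2 ≤ F y := by
    intro y hy
    rcases eq_or_ne y (extChartAt (𝓡 4) p p) with hyy | hyy
    · rw [hyy, extChartAt_to_inv]
      have : Q p = 0 := hvanp
      rw [this]
      simpa using hF0 (extChartAt (𝓡 4) p p)
    have hx : (extChartAt (𝓡 4) p).symm y ≠ p := CapFactorRound.extChartAt_symm_ne_pole (hsub hy) hyy
    have hd : 0 < ‖y - (extChartAt (𝓡 4) p p)‖ := norm_pos_iff.mpr (sub_ne_zero.mpr hyy)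
    have hGy : G ((extChartAt (𝓡 4) p).symm y) = a / ‖y - (extChartAt (𝓡 4) p p)‖ ^ 2 + b :=
      hGeq y hy hyy
    by_cases hann : ‖y - (extChartAt (𝓡 4) p p)‖ ∈ Icc ρ₁ ρ₂
    · -- on the annulus: `Q ≤ (C/log²S) G⁻²|∇G|² ≤ κ/‖y−y₀‖²`
      have hgrad : g.gradSq G ((extChartAt (𝓡 4) p).symm y) =
          4 * a ^ 2 / (‖y - (extChartAt (𝓡 4) p p)‖ ^ 2) ^ 3 := by
        rw [stub_gradSqFlatChart M g p y (hsub hy) (hflat y hy) G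
          ((CapFactorRound.contMDiffAt_green hGs hx).mdifferentiableAt (by simp)),
          CapFactorSchwarzschild.gradient_green_comp_symm hGs hr hsub hGeq hy hyy,
          CapFactorRound.norm_model_gradient_sq a hyy]
      have hQy : Q ((extChartAt (𝓡 4) p).symm y) ≤ κ * (‖y - (extChartAt (𝓡 4) p p)‖ ^ 2)⁻¹ := by
        refine (hbound _ hx).trans ?_
        rw [hgrad, hGy, hκ, mul_assoc]
        exact mul_le_mul_of_nonneg_left (inv_sq_mul_gradSq_model_le ha hb (by positivity))
          (by positivity)
      have hFy : F y = (κ * (‖y - (extChartAt (𝓡 4) p p)‖ ^ 2)⁻¹) ^ 2 := by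
        simp only [hF, indicator_of_mem hann]
        field_simp
      rw [hFy]
      exact pow_le_pow_left₀ (hQ0 _) hQy 2
    · -- off the annulus: `Q = 0`
      have hQy : Q ((extChartAt (𝓡 4) p).symm y) = 0 := by
        rw [mem_Icc, not_and_or, not_le, not_le] at hann
        rcases hann with hlt | hgt
        · -- `‖y−y₀‖ < ρ₁`: `G > S²`
          refine hvan2 _ hx ?_
          rw [hGy]
          have h' : ‖y - (extChartAt (𝓡 4) p p)‖ ^ 2 < ρ₁ ^ 2 :=
            pow_lt_pow_left₀ hlt (norm_nonneg _) two_ne_zero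
          rw [hρ₁sq, lt_div_iff₀ (by positivity)] at h'
          have h'' : S ^ 2 < a / ‖y - (extChartAt (𝓡 4) p p)‖ ^ 2 := by
            rw [lt_div_iff₀ (by positivity)]
            linarith
          linarith
        · -- `‖y−y₀‖ > ρ₂`: `G < S`
          refine hvan1 _ hx ?_
          rw [hGy]
          have h' : ρ₂ ^ 2 < ‖y - (extChartAt (𝓡 4) p p)‖ ^ 2 :=
            pow_lt_pow_left₀ hgt (Real.sqrt_nonneg _) two_ne_zero
          rw [hρ₂sq, div_lt_iff₀ hS0] at h'
          have h'' : a / ‖y - (extChartAt (𝓡 4) p p)‖ ^ 2 < S / 2 := by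
            rw [div_lt_iff₀ (by positivity)]
            linarith
          linarith
      rw [hQy]
      simpa using hF0 y
  -- (6) integrate
  have hFint : Integrable F := by
    have h := (GluingCutoffBound.integrable_annulus (ρ₂ := ρ₂) hρ₁pos).comp_sub_right
      (extChartAt (𝓡 4) p p)
    exact h.const_mul (κ ^ 2)
  have hstep6 : ∫ y in Metric.closedBall (extChartAt (𝓡 4) p p) r,
      (Q ((extChartAt (𝓡 4) p).symm y)) ^ 2 ≤ ∫ y, F y := by
    calc ∫ y in Metric.closedBall (extChartAt (𝓡 4) p p) r, (Q ((extChartAt (𝓡 4) p).symm y)) ^ 2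
        ≤ ∫ y in Metric.closedBall (extChartAt (𝓡 4) p p) r, F y := by
          refine setIntegral_mono_on ?_ hFint.integrableOn measurableSet_closedBall hpt
          refine Integrable.mono' hFint.integrableOn ?_ ?_
          · have hcont : ContinuousOn (fun y ↦ (Q ((extChartAt (𝓡 4) p).symm y)) ^ 2)
                (Metric.closedBall (extChartAt (𝓡 4) p p) r) :=
              ((hQc.pow 2).comp_continuousOn ((continuousOn_extChartAt_symm p).mono hsub))
            exact hcont.aestronglyMeasurable measurableSet_closedBall
          · refine (ae_restrict_iff' measurableSet_closedBall).2 (ae_of_all _ fun y hy ↦ ?_)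
            rw [Real.norm_eq_abs, abs_of_nonneg (sq_nonneg _)]
            exact hpt y hy
      _ ≤ ∫ y, F y := setIntegral_le_integral hFint (ae_of_all _ hF0)
  have hstep7 : ∫ y, F y = κ ^ 2 * (2 * Real.pi ^ 2 * Real.log (ρ₂ / ρ₁)) := by
    simp only [hF]
    rw [integral_const_mul]
    congr 1
    have := MeasureTheory.integral_sub_right_eq_self
      (μ := (volume : Measure (EuclideanSpace ℝ (Fin 4))))
      (fun z : EuclideanSpace ℝ (Fin 4) ↦ (Icc ρ₁ ρ₂).indicator (fun t : ℝ ↦ (t ^ 4)⁻¹) ‖z‖)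
      (extChartAt (𝓡 4) p p)
    rw [this, GluingCutoffBound.integral_annulus_inv_pow_four hρ₁pos hρ₁₂]
  -- (7) `log (ρ₂/ρ₁) = log √(2S) ≤ log S` for `S ≥ 2`
  have hlog : Real.log (ρ₂ / ρ₁) ≤ Real.log S :=
    Real.log_le_log (by positivity) (sqrt_ratio_le ha hS)
  calc ∫ x, (Q x) ^ 2 ∂μ
      = ∫ y in Metric.closedBall (extChartAt (𝓡 4) p p) r, (Q ((extChartAt (𝓡 4) p).symm y)) ^ 2 := by
        rw [hstep3, hstep4]
    _ ≤ ∫ y, F y := hstep6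
    _ = κ ^ 2 * (2 * Real.pi ^ 2 * Real.log (ρ₂ / ρ₁)) := hstep7
    _ ≤ κ ^ 2 * (2 * Real.pi ^ 2 * Real.log S) := by gcongr
    _ = (C / Real.log S ^ 2) ^ 2 * (32 * Real.pi ^ 2 * Real.log S) := by rw [hκ]; ring

end Manifold

end GluingCutoffBoundSchwarzschild

/-- **Stub Cut' of line `green-blowup-conformal-entropy` (registered form): the `L²`-norm of the
logarithmic cut-off gradients in the flat gauge with mass.** For Green data `G ∘ φ⁻¹ = a/‖y − y₀‖² + b`
on the flat chart ball and logarithmic cut-offs across the annulus `{S ≤ G ≤ S²}` captured by the open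
chart ball, `∫ (|∇χ₁|²_g + |∇χ₂|²_g)² dV_g ≤ (C/log²S)² · 32π² log S` whenever `2 ≤ S`, `2b ≤ S`
(∀-form of `GluingCutoffBoundSchwarzschild.cutoff_sq_integral_le`). [folklore] -/
theorem stub_cutoffSqIntegralSchwarzschild :
    ∀ (M : Type) [TopologicalSpace M] [T2Space M] [SecondCountableTopology M]
      [ChartedSpace (EuclideanSpace ℝ (Fin 4)) M] [IsManifold (𝓡 4) ∞ M] [CompactSpace M]
      [T3Space M] [MeasurableSpace M] [BorelSpace M]
      (g : PseudoRiemannianMetric (𝓡 4) ∞ (EuclideanSpace ℝ (Fin 4)) (TangentSpace (𝓡 4) : M → Type _))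
      [g.HasLeviCivita] (hg : g.IsRiemannian) (p : M) (G : M → ℝ),
      ContMDiffOn (𝓡 4) 𝓘(ℝ, ℝ) ∞ G {p}ᶜ → ∀ (a b r : ℝ), 0 < a → 0 ≤ b → 0 < r →
      Metric.closedBall (extChartAt (𝓡 4) p p) r ⊆ (extChartAt (𝓡 4) p).target →
      (∀ y ∈ Metric.closedBall (extChartAt (𝓡 4) p p) r, ∀ X W : EuclideanSpace ℝ (Fin 4),
          g.val ((extChartAt (𝓡 4) p).symm y)
            (mfderiv 𝓘(ℝ, EuclideanSpace ℝ (Fin 4)) (𝓡 4) (extChartAt (𝓡 4) p).symm y X)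
            (mfderiv 𝓘(ℝ, EuclideanSpace ℝ (Fin 4)) (𝓡 4) (extChartAt (𝓡 4) p).symm y W) = ⟪X, W⟫) →
      (∀ y ∈ Metric.closedBall (extChartAt (𝓡 4) p p) r, y ≠ extChartAt (𝓡 4) p p →
          G ((extChartAt (𝓡 4) p).symm y) = a / ‖y - extChartAt (𝓡 4) p p‖ ^ 2 + b) →
      ∀ (C S : ℝ), 0 ≤ C → 2 ≤ S → 2 * b ≤ S → a / r ^ 2 + b < S →
      ∀ (χ₁ χ₂ : M → ℝ), ContMDiff (𝓡 4) 𝓘(ℝ, ℝ) ∞ χ₁ → ContMDiff (𝓡 4) 𝓘(ℝ, ℝ) ∞ χ₂ →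
      (∀ y, χ₁ y ^ 2 + χ₂ y ^ 2 = 1) → (∀ x, x ≠ p → G x ≤ S → χ₁ x = 1) →
      (∀ x, x ≠ p → S ^ 2 ≤ G x → χ₁ x = 0) → χ₁ p = 0 →
      (∀ x, x ≠ p → g.gradSq χ₁ x + g.gradSq χ₂ x ≤ C / Real.log S ^ 2 * ((G x)⁻¹ ^ 2 * g.gradSq G x)) →
      Tendsto G (𝓝[≠] p) atTop →
      (∀ x, x ≠ p → S ≤ G x →
        x ∈ (extChartAt (𝓡 4) p).source ∧ extChartAt (𝓡 4) p x ∈ Metric.ball (extChartAt (𝓡 4) p p) r) →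
      ∫ x, (g.gradSq χ₁ x + g.gradSq χ₂ x) ^ 2 ∂(riemannianMeasure (g.toContMDiffRiemannianMetric hg)) ≤
        (C / Real.log S ^ 2) ^ 2 * (32 * Real.pi ^ 2 * Real.log S) := by
  intro M _ _ _ _ _ _ _ _ _ g _ hg p G hGs a b r ha hb hr hsub hflat hGeq C S hC hS hbS _harS χ₁ χ₂ hχ₁
    hχ₂ h1 hone hzero hχ₁p hbound hGlim hcapt
  exact GluingCutoffBoundSchwarzschild.cutoff_sq_integral_le g hg hGs ha hb hr hsub hflat hGeq hC hS
    hbS hχ₁ hχ₂ h1 hone hzero hχ₁p hbound hGlim hcapt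

end Summit.SmoothPoincare4.SmoothPoincare4.Theorems

end
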